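import Summits.BirchSwinnertonDyer.BirchSwinnertonDyer.Theorems.SignedLowerHalvesSmallImageLowerHalfBothSignsRttEulerLayerKBridge
import HarnessLib

/-!
# Route `SignedLowerHalves`, crux L `SmallImageLowerHalfBothSigns` (item stmt-BirchSwinnertonDyer-23599), line `rtt_w3` —
# the partner Selmer bound (PSB) only sees the BAD places: reduction of the `S₀`-sums to `{v ∈ S₀ : ℓ_v ∣ M or W bad at v}`

Width seat `bsd-line-slh-p3-w3` g12 under LEAD `cruxlead-stmt-BirchSwinnertonDyer-23599` (cell `bsd-ssimc`); ROUTE-INDEPENDENT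
helper (`--supports stmt-BirchSwinnertonDyer-23599`); THEOREMS ONLY — no definition, no named fact, no `sorry`; closes nothing;
BSD is not proved by any of this.

WHAT. In (PSB) (hypothesis of `partnerLayerLambdaLowerT2_ns_of_partnerSelmerBoundT2_ns`, p749357) both sides carry a sum over the
admissible set `S₀` (⊇ bad(W) ∪ primes(M), possibly larger): the partner's local terms `p^{v_p(f_ℓ)}·λ(P_{g,ℓ}(ℓ⁻¹(X+1)))` on the left,
Greenberg–Vatsal's `δ_W^{(v)}` on the right. By `pow_mul_layerLambda_partnerLocal_eq_delta_of_good` (p749620) the two terms AGREE at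
every `v ∈ S₀` prime to `M` where `W` has good reduction, granted the congruence `‖ι a_ℓ(g) − a_ℓ(W)‖ < 1` there (ENG's hypothesis off
`p·M·N_W`). Hence (odd `p`):

* `sum_partnerLocal_eq_sum_bad_add_sum_delta_good` — `Σ_{S₀} g-terms = Σ_{S₀ ∩ bad} g-terms + Σ_{S₀ ∩ good} δ_W`;
* **`partnerSelmerBound_of_badPart`** — `d + Σ_{S₀ ∩ bad} g-terms ≤ B + Σ_{S₀ ∩ bad} δ_W` implies `d + Σ_{S₀} g-terms ≤ B + Σ_{S₀} δ_W`
  (`bad = {v : ℓ_v ∣ M ∨ ¬ W good at v}`): the research residue (PSB) may be stated on the bad places of `W` and of `M` alone.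

References: [GreenbergVatsal2000] §2 Prop. (2.4), §1 (9); [BDKim2009] Cor. 2.13; [PollackWeston2011MT] §3.1.
-/

set_option autoImplicit false
-- D-0017: single-problem summit, the namespace repeats the problem name by design.
set_option linter.dupNamespace false
noncomputable section

open scoped Classical MatrixGroups ModularForm

open Polynomial NumberField IsDedekindDomain WeierstrassCurve Literature.NumberTheory.EllipticCurves
  Literature.NumberTheory.EllipticCurves.ModularForms Literature.NumberTheory.EllipticCurves.GreenbergVatsal2000
  Literature.NumberTheory.IwasawaTheory Rat.HeightOneSpectrum
  Summit.BirchSwinnertonDyer.Rank1Residual.X2.EulerFactorInvariants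
  Summit.BirchSwinnertonDyer.BirchSwinnertonDyer.Theorems.SmallImageRttOneSided

namespace Summit.BirchSwinnertonDyer.BirchSwinnertonDyer.Theorems.SmallImageRttLayerLawK

variable {p : ℕ} [hp : Fact p.Prime] (W : WeierstrassCurve ℚ) [W.IsElliptic] [W.IsGloballyMinimal] (M : ℕ)
  (a : HeightOneSpectrum (𝓞 ℚ) → PadicAlgCl p)

/-- **The partner's local sum splits into its bad part plus `W`'s `δ` on the good part** (odd `p`): for a finite set `S₀` of places
`≠ p`, coefficients `a_v` (`= ι a_{ℓ_v}(g)`) of norm `≤ 1` congruent to `a_{ℓ_v}(W)` at the places of `S₀` prime to `M` where `W` is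
good, `Σ_{v∈S₀} p^{v_p(f_ℓ)}·λ(P_{g,ℓ}(ℓ⁻¹(X+1))) = Σ_{v∈S₀, bad} (same) + Σ_{v∈S₀, good} δ_W^{(v)}`, `bad = {ℓ_v ∣ M ∨ ¬ W good at v}`.
[cite: GreenbergVatsal2000, §2 Prop. (2.4) (p. 22) and §1 (9)] -/
theorem sum_partnerLocal_eq_sum_bad_add_sum_delta_good (hp2 : p ≠ 2) (S₀ : Finset (HeightOneSpectrum (𝓞 ℚ)))
    (hS : ∀ v ∈ S₀, natGenerator v ≠ p) (ha : ∀ v ∈ S₀, ‖a v‖ ≤ 1)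
    (hcong : ∀ v ∈ S₀, ¬ natGenerator v ∣ M → W.HasGoodReductionAt v →
      ‖a v - (W.frobeniusTrace (natGenerator v) : PadicAlgCl p)‖ < 1) :
    ∑ v ∈ S₀, p ^ (frobeniusExponent p (natGenerator v : ℤ_[p])).valuation *
        layerLambda ((1 - C (a v) * X + (if natGenerator v ∣ M then 0 else C (natGenerator v : PadicAlgCl p)) * X ^ 2).comp
          (C ((natGenerator v : PadicAlgCl p)⁻¹) * (X + 1))) =
      ∑ v ∈ S₀.filter (fun v ↦ natGenerator v ∣ M ∨ ¬ W.HasGoodReductionAt v),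
          p ^ (frobeniusExponent p (natGenerator v : ℤ_[p])).valuation *
            layerLambda ((1 - C (a v) * X + (if natGenerator v ∣ M then 0 else C (natGenerator v : PadicAlgCl p)) * X ^ 2).comp
              (C ((natGenerator v : PadicAlgCl p)⁻¹) * (X + 1))) +
        ∑ v ∈ S₀.filter (fun v ↦ ¬ (natGenerator v ∣ M ∨ ¬ W.HasGoodReductionAt v)), delta W p v := by
  rw [← Finset.sum_filter_add_sum_filter_not S₀ (fun v ↦ natGenerator v ∣ M ∨ ¬ W.HasGoodReductionAt v)]
  congr 1
  refine Finset.sum_congr rfl fun v hv ↦ ?_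
  rw [Finset.mem_filter, not_or, not_not] at hv
  obtain ⟨hvS, hM, hgood⟩ := hv
  exact pow_mul_layerLambda_partnerLocal_eq_delta_of_good W v hp2 (hS v hvS) M hM hgood (ha v hvS) (hcong v hvS hM hgood)

omit hp [W.IsElliptic] [W.IsGloballyMinimal] in
/-- `W`'s `δ`-sum splits the same way (trivially). [cite: GreenbergVatsal2000, §1 (9)] -/
theorem sum_delta_eq_sum_bad_add_sum_good (S₀ : Finset (HeightOneSpectrum (𝓞 ℚ))) :
    ∑ v ∈ S₀, delta W p v =
      ∑ v ∈ S₀.filter (fun v ↦ natGenerator v ∣ M ∨ ¬ W.HasGoodReductionAt v), delta W p v +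
        ∑ v ∈ S₀.filter (fun v ↦ ¬ (natGenerator v ∣ M ∨ ¬ W.HasGoodReductionAt v)), delta W p v :=
  (Finset.sum_filter_add_sum_filter_not S₀ _ _).symm

/-- **(PSB) may be checked on the bad places alone.** Under the hypotheses of `sum_partnerLocal_eq_sum_bad_add_sum_delta_good`, if
`d + Σ_{v∈S₀, bad} p^{v_p(f_ℓ)}·λ(P_{g,ℓ}(ℓ⁻¹(X+1))) ≤ B + Σ_{v∈S₀, bad} δ_W^{(v)}` (`bad = {ℓ_v ∣ M ∨ ¬ W good at v}`) then the full
inequality `d + Σ_{v∈S₀} (g-terms) ≤ B + Σ_{v∈S₀} δ_W^{(v)}` of (PSB) holds (the good parts are equal). [cite: GreenbergVatsal2000, §2 Prop. (2.4) and §1 (9)]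
[cite: BDKim2009, Cor. 2.13] -/
theorem partnerSelmerBound_of_badPart (hp2 : p ≠ 2) (S₀ : Finset (HeightOneSpectrum (𝓞 ℚ)))
    (hS : ∀ v ∈ S₀, natGenerator v ≠ p) (ha : ∀ v ∈ S₀, ‖a v‖ ≤ 1)
    (hcong : ∀ v ∈ S₀, ¬ natGenerator v ∣ M → W.HasGoodReductionAt v →
      ‖a v - (W.frobeniusTrace (natGenerator v) : PadicAlgCl p)‖ < 1) {d B : ℕ}
    (hbad : d + ∑ v ∈ S₀.filter (fun v ↦ natGenerator v ∣ M ∨ ¬ W.HasGoodReductionAt v),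
          p ^ (frobeniusExponent p (natGenerator v : ℤ_[p])).valuation *
            layerLambda ((1 - C (a v) * X + (if natGenerator v ∣ M then 0 else C (natGenerator v : PadicAlgCl p)) * X ^ 2).comp
              (C ((natGenerator v : PadicAlgCl p)⁻¹) * (X + 1))) ≤
      B + ∑ v ∈ S₀.filter (fun v ↦ natGenerator v ∣ M ∨ ¬ W.HasGoodReductionAt v), delta W p v) :
    d + ∑ v ∈ S₀, p ^ (frobeniusExponent p (natGenerator v : ℤ_[p])).valuation *
        layerLambda ((1 - C (a v) * X + (if natGenerator v ∣ M then 0 else C (natGenerator v : PadicAlgCl p)) * X ^ 2).comp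
          (C ((natGenerator v : PadicAlgCl p)⁻¹) * (X + 1))) ≤
      B + ∑ v ∈ S₀, delta W p v := by
  rw [sum_partnerLocal_eq_sum_bad_add_sum_delta_good W M a hp2 S₀ hS ha hcong, sum_delta_eq_sum_bad_add_sum_good W M S₀]
  omega

end Summit.BirchSwinnertonDyer.BirchSwinnertonDyer.Theorems.SmallImageRttLayerLawK

end
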